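import Literature.Geometry.Lorentzian.InverseMeanCurvatureFlowExteriorMetricFamily
import Literature.Geometry.Lorentzian.InverseMeanCurvatureFlowUniqueness
import HarnessLib

/-!
# Inverse mean curvature flow: the elliptic-regularisation package of Huisken–Ilmanen's proof of
  the Weak Existence Theorem 3.1 (Lemmas 3.4–3.5 for the modified metrics `g_L`; named fact), and
  `weak_existence` assembled from it

Librarian fact-decomposition (libsplit-27, 2026-08-16) of the capped named fact
`Literature.Geometry.Lorentzian.weak_existence` (`InverseMeanCurvatureFlow.lean`): Huisken–Ilmanen,
J. Differential Geom. 59 (2001), **Thm. 3.1** (Weak Existence Theorem; `n = 3`, noncompact connected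
complete `X`, without the gradient estimate (3.1)). The fact's seats PROVED everything in the
printed proof of Thm. 3.1 except the elliptic theory of the regularised equation
`(⋆)_ε : div(∇u/√(|∇u|² + ε²)) = √(|∇u|² + ε²)`: the Uniqueness Theorem 2.2 (`weak_uniqueness`,
`InverseMeanCurvatureFlowUniqueness.lean` — the clause "which is unique on `M ∖ E₀`"), the
Compactness Theorem 2.1 (`…Compactness.lean`, `…ApproxCompactness.lean`), the calibration argument
and the limit `ε → 0` (`…Calibration.lean`, `…RegularisedLimit.lean`), the assembly of the initial
value problem, the limit `L → ∞`, properness and the pointwise bounds by chaining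
(`…IVPAssembly.lean`, `…ExteriorAssembly.lean`, `…ExteriorExistence.lean`, `…Chaining.lean`), and
the transfer between the given metric `h` and the modified metrics `g_L` of step 2 of the printed
proof (`…MetricLocality.lean`, `…ExteriorMetricFamily.lean`), culminating in
`weak_existence_of_regularised_dirichlet_solutions_metric : H → weak_existence`.

What remains is its hypothesis `H` — in print, step 2 of the proof of Thm. 3.1 (p. 27: the
complete metrics `g_L` on `U_L ⊇ F̄_L`, "`g_L = g` on `F_L`, `g_L ≥ g` on all of `U_L`", conic near
`∂U_L`) together with **Lemma 3.4** (the estimates (3.6)–(3.9) for smooth solutions `u^ε` of the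
regularised Dirichlet problem `(⋆)_ε` on `Ω_L`) and the **Approximate Existence Lemma 3.5** ("a
smooth solution of `(⋆)_ε` on `Ω̄_L` exists for all sufficiently small `ε > 0`", by the continuity
method in `C^{2,α}`). This file

* vendors `H` VERBATIM as ONE child named fact `regularised_dirichlet_solutions` (a `def … : Prop`;
  its content is Hölder-space elliptic theory — Schauder estimates up to the boundary, the
  continuity/implicit-function method, the maximum principle for `(⋆)_ε` — absent from Mathlib), and
* PROVES the assembly `weak_existence_holds_of : regularised_dirichlet_solutions → weak_existence`
  (one line), and records the bookkeeping that, `weak_uniqueness` being a theorem,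
  `weak_existence` is equivalent to its existence clause (`weak_existence_iff_weak_solution_exists`).

The child does not restate the parent: it asserts the solvability, with estimates, of a family of
REGULARISED elliptic Dirichlet problems for auxiliary metrics, not the existence of weak solutions of
(††). Its binder shape (an exhaustion `U_L`, solutions `w_{L,k} ∈ C²` of `(⋆)_{ε_{L,k}}` for `g_L` on
`U_L ∖ Ē₀` with `ε_{L,k} → 0`, local gradient bounds (3.9) uniform in `k` and eventually in `L`,
Lipschitz bounds up to `∂E₀` with `w = 0` there ((3.7)), `w ≥ −η_{L,k} → 0`, the sup bound
`w ≤ B_L` (maximum principle, `u^ε ≤ L − 2`), the lower barrier `w ≥ b_L − δ` off compact subsets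
of `U_L` ((3.7) at the outer boundary), `b_L → ∞`) is the seats' transcription of the output of
Lemmas 3.4–3.5, designed against the held text; it is kept unchanged so that the proved reduction
applies definitionally.

## References

* G. Huisken, T. Ilmanen, *The inverse mean curvature flow and the Riemannian Penrose inequality*,
  J. Differential Geom. 59 (2001) 353–437: §3, Thm. 3.1 and its proof (steps 1–2, p. 26–27 of the
  journal), `(⋆)_ε`, Lemma 3.4 ((3.6)–(3.10)), Approximate Existence Lemma 3.5; §2 Thm. 2.1, 2.2.
  Read: `lit read doi:10.4310/jdg/1090349447`, file pp. 27–36. [HuiskenIlmanenIMCF2001]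
-/

noncomputable section

open Bundle Set Manifold TopologicalSpace Filter MeasureTheory Function
open scoped ContDiff Topology ENNReal NNReal Manifold Real

namespace Literature.Geometry.Lorentzian

open PseudoRiemannianMetric

/-- **The elliptic-regularisation package of the proof of Huisken–Ilmanen's Thm. 3.1 (Lemmas 3.4–3.5
for the modified metrics `g_L` of step 2; NAMED FACT, not proved here).** Printed: Lemma 3.4 —
for the regularised Dirichlet problem `(⋆)_ε` on `Ω_L = F_L ∖ Ē₀` (`E^ε u := div(∇u/√(|∇u|²+ε²)) −
√(|∇u|²+ε²) = 0`, `u = 0` on `∂E₀`, `u = L − 2` on `∂F_L`) every smooth solution satisfies the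
estimates (3.6)–(3.9) (`u ≥ −ε`-type lower bound, `|∇u| ≤ max_{∂E₀} H₊ + ε` near `∂E₀` and
`|∇u| ≤ C(L)` on `Ω̄_L`, the interior gradient estimate (3.1)/(3.9) independent of `ε` and `L`);
Lemma 3.5 (Approximate Existence) — "a smooth solution of `(⋆)_ε` on `Ω̄_L` exists for all
sufficiently small `ε > 0`"; and step 2 of the proof of Thm. 3.1 — complete metrics `g_L ≥ g`,
`g_L = g` on `F_L`, conic near the outer boundary, for which these lemmas are applied and
`min(v, L)` "remains a weak subsolution … with respect to `g_L`". Tree form (verbatim the hypothesis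
of the proved reduction `weak_existence_of_regularised_dirichlet_solutions_metric`): for every datum
of `weak_existence` (complete connected noncompact `(X, h)`, a proper weak subsolution `v` at
infinity with precompact `F₀ = {v < 0} ⊇ Ē₀`, a nonempty smooth precompact open `E₀`) there are
levels `c_L ≥ 0`, `c_L → ∞`, smooth metrics `g_L ≥ h` with Levi-Civita connections and `g_L = h` on
`{v < c_L}`, an increasing open exhaustion `U_L ⊇ Ē₀` of `X`, and classical solutions
`w_{L,k} ∈ C²(X)` of `(⋆)_{ε_{L,k}}` for `g_L` on `U_L ∖ Ē₀` (`ψ Δ_g w − g(∇ψ, ∇w) = ψ³`,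
`ψ = √(|∇w|²_g + ε²)`, which is `(⋆)_ε` multiplied by `ψ²`), `ε_{L,k} → 0`, with: local gradient
bounds for `g_L` uniform in `k` on `U_L ∖ Ē₀` and uniform in `(L, k)` eventually near each point of
`X ∖ Ē₀` ((3.9)); Lipschitz bounds (for `d_h`) near `∂E₀` uniform in `(L, k)` and `w = 0` on `∂E₀`
((3.7)); `w ≥ −η_{L,k}`, `η_{L,k} → 0` ((3.6)); the sup bound `w_{L,k} ≤ B_L` (maximum principle);
and the lower barrier `w ≥ b_L − δ` off compact subsets of `U_L` for every `δ > 0`, `b_L → ∞`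
((3.7) at the outer boundary, `u = L − 2` on `∂F_L`). The one child of the decomposition of
`weak_existence`. [cite: HuiskenIlmanenIMCF2001, Lemmas 3.4–3.5 and proof of Thm. 3.1, step 2] -/
def regularised_dirichlet_solutions : Prop :=
  ∀ (X : Type) [TopologicalSpace X] [ChartedSpace E3 X] [IsManifold (𝓡 3) ∞ X]
    [T2Space X] [SecondCountableTopology X] [LocallyCompactSpace X] [ConnectedSpace X]
    [NoncompactSpace X] [MeasurableSpace X] [BorelSpace X]
    (h : ContMDiffRiemannianMetric (𝓡 3) ∞ E3 (TangentSpace (𝓡 3) : X → Type _))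
    [(ofRiemannian h).HasLeviCivita],
    IsGeodesicallyComplete (ofRiemannian h).leviCivita →
    ∀ (E₀ F₀ : Set X) (v : X → ℝ), E₀.Nonempty → IsSmoothPrecompactOpen E₀ →
      IsWeakSubsolutionIVP h v F₀ → IsProperFun v → IsCompact (closure F₀) → closure E₀ ⊆ F₀ →
      ∃ (c : ℕ → ℝ) (g : ℕ → ContMDiffRiemannianMetric (𝓡 3) ∞ E3 (TangentSpace (𝓡 3) : X → Type _))
        (_ : ∀ L, (ofRiemannian (g L)).HasLeviCivita)
        (U : ℕ → Set X) (w : ℕ → ℕ → X → ℝ) (ε : ℕ → ℕ → ℝ) (ψ : ℕ → ℕ → X → ℝ)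
        (η : ℕ → ℕ → ℝ) (b : ℕ → ℝ),
        (∀ L, 0 ≤ c L) ∧ Tendsto c atTop atTop ∧
        (∀ L (x : X) (ξ : TangentSpace (𝓡 3) x), h.inner x ξ ξ ≤ (g L).inner x ξ ξ) ∧
        (∀ L x, v x < c L → h.inner x = (g L).inner x) ∧
        (∀ L, IsOpen (U L)) ∧ (∀ L, closure E₀ ⊆ U L) ∧ (∀ L M : ℕ, L ≤ M → U L ⊆ U M) ∧
        (∀ K : Set X, IsCompact K → ∃ L, K ⊆ U L) ∧ Tendsto b atTop atTop ∧
        (∀ L k, ContMDiff (𝓡 3) 𝓘(ℝ, ℝ) 2 (w L k)) ∧ (∀ L k, 0 < ε L k) ∧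
        (∀ L, Tendsto (ε L) atTop (𝓝 0)) ∧
        (∀ L k x, ψ L k x = Real.sqrt (gradNorm (g L) (w L k) x ^ 2 + ε L k ^ 2)) ∧
        (∀ L k, ContMDiffOn (𝓡 3) 𝓘(ℝ, ℝ) 1 (ψ L k) (U L \ closure E₀)) ∧
        (∀ L k, ∀ x ∈ U L \ closure E₀, ψ L k x * (ofRiemannian (g L)).dalembertian (w L k) x -
          (ofRiemannian (g L)).innerDual x (mvfderiv (𝓡 3) (ψ L k) x).toLinearMap
            (mvfderiv (𝓡 3) (w L k) x).toLinearMap = ψ L k x ^ 3) ∧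
        (∀ L, ∀ x ∈ U L \ closure E₀, ∃ C : ℝ≥0, ∃ V ∈ 𝓝 x, ∀ k, ∀ q ∈ V,
          gradNorm (g L) (w L k) q ≤ C) ∧
        (∀ x, x ∉ closure E₀ → ∃ C : ℝ≥0, ∃ V ∈ 𝓝 x, ∃ L₀ : ℕ, ∀ L, L₀ ≤ L → ∀ k, ∀ q ∈ V,
          gradNorm (g L) (w L k) q ≤ C) ∧
        (letI : RiemannianBundle (fun x : X ↦ TangentSpace (𝓡 3) x) :=
            ⟨h.toContinuousRiemannianMetric.toRiemannianMetric⟩;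
          letI : PseudoEMetricSpace X := .ofRiemannianMetric (𝓡 3) X;
          ∀ x ∈ frontier E₀, ∃ K : ℝ≥0, ∃ V ∈ 𝓝 x, ∀ L k,
            LipschitzOnWith K (w L k) (V ∩ E₀ᶜ)) ∧
        (∀ L k, ∀ x ∈ frontier E₀, w L k x = 0) ∧
        (∀ L, Tendsto (η L) atTop (𝓝 0)) ∧ (∀ L k, ∀ x ∈ U L, x ∉ E₀ → -η L k ≤ w L k x) ∧
        (∀ L, ∃ B : ℝ, ∀ k, ∀ x ∈ U L, x ∉ E₀ → w L k x ≤ B) ∧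
        (∀ L, ∀ δ : ℝ, 0 < δ → ∃ C : Set X, IsCompact C ∧ C ⊆ U L ∧
          ∀ k, ∀ x ∈ U L, x ∉ C → b L - δ ≤ w L k x)

/-- **Assembly of the decomposition: the regularised Dirichlet solutions (Lemmas 3.4–3.5, step 2)
⟹ `weak_existence` (Thm. 3.1)**, by the seats' proved reduction
`weak_existence_of_regularised_dirichlet_solutions_metric` (Compactness Theorem 2.1, calibration,
limits `ε → 0` and `L → ∞`, chaining, properness, and the Uniqueness Theorem 2.2 for the clause
"unique on `M ∖ E₀`"). [cite: HuiskenIlmanenIMCF2001, Thm. 3.1] -/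
theorem weak_existence_holds_of (H : regularised_dirichlet_solutions) : weak_existence :=
  weak_existence_of_regularised_dirichlet_solutions_metric H

/-- **Bookkeeping: with the Uniqueness Theorem 2.2 proved (`weak_uniqueness`), `weak_existence` is
equivalent to its existence clause** — a proper weak solution of (††) with initial condition `E₀`
exists under the hypotheses of Thm. 3.1 (written out in full; no named fact is introduced for it).
[cite: HuiskenIlmanenIMCF2001, Thm. 3.1 with Thm. 2.2 (iii)] -/
theorem weak_existence_iff_weak_solution_exists :
    weak_existence ↔
    ∀ (X : Type) [TopologicalSpace X] [ChartedSpace E3 X] [IsManifold (𝓡 3) ∞ X] [T2Space X]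
      [SecondCountableTopology X] [LocallyCompactSpace X] [ConnectedSpace X] [NoncompactSpace X]
      [MeasurableSpace X] [BorelSpace X]
      (h : ContMDiffRiemannianMetric (𝓡 3) ∞ E3 (TangentSpace (𝓡 3) : X → Type _))
      [(ofRiemannian h).HasLeviCivita],
      IsGeodesicallyComplete (ofRiemannian h).leviCivita →
      (∃ (v : X → ℝ) (F₀ : Set X), IsProperFun v ∧ IsCompact (closure F₀) ∧
        IsWeakSubsolutionIVP h v F₀) →
      ∀ E₀ : Set X, E₀.Nonempty → IsSmoothPrecompactOpen E₀ →
        ∃ u : X → ℝ, IsProperFun u ∧ IsWeakSolutionIVP h u E₀ := by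
  constructor
  · intro hW X _ _ _ _ _ _ _ _ _ _ h _ hcomplete hsub E₀ hne hE₀
    obtain ⟨u, hu, hsol, -⟩ := hW X h hcomplete hsub E₀ hne hE₀
    exact ⟨u, hu, hsol⟩
  · intro hE X _ _ _ _ _ _ _ _ _ _ h _ hcomplete hsub E₀ hne hE₀
    obtain ⟨u, hu, hsol⟩ := hE X h hcomplete hsub E₀ hne hE₀
    exact ⟨u, hu, hsol, fun u' hu' hsol' x hx =>
      weak_uniqueness X h E₀ hE₀.2.1 u hu hsol u' hu' hsol' x hx⟩

end Literature.Geometry.Lorentzian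

end
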